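import Summits.NavierStokesRegularity.NavierStokesRegularity.Theorems.HodographBetchovNoFastEnergyConcentrationStubTightnessOfMorrey

/-!
# `NoFastEnergyConcentration` (stmt-NavierStokesRegularity-18118) from the energy Morrey bound

Piece X₁ of the BC2 split of crux `FastClassSqueeze` (stmt-NavierStokesRegularity-15832, route `HodographBetchov`),
line `morrey-nullset` (`Cruxes/FastClassSqueeze/Lines/pieceX1_morrey_nullset.lean`).  With the line's stub 2 landed
(`MorreyNullset.stub_tightness_of_morrey`, this directory), the line is CLOSED MODULO its stub 1, the Type-I-in-space
energy Morrey bound.  This file records that closure as tree theorems, per flow and globally: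

* `conclusion_of_energyMorreyBound` — ONE FLOW: if a classical solution of unforced Navier–Stokes on `ℝ³ × [0,T)`,
  Leray–Hopf from a rapidly decaying datum, satisfies `∫_{B_r(x₀)} |u(t)|² ≤ C r` for all centres, all `r ∈ (0,r₀)`
  and all `t ∈ [0,T)` with `T − r² < t`, then its kinetic energy is uniformly integrable over speed classes up to `T`
  (`∀ ε ∃ l ∀ t < T: ∫_{|u(t)|>l} |u(t)|² ≤ ε`) — the skeleton's assembly with the landed stub: tightness near the compact
  `ℋ¹`-null top singular set (`stub_tightness_of_morrey`), high fast classes inside that neighbourhood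
  (`Germ.exists_fastClass_subset`), boundedness on the early closed slab (`Birth.exists_forall_norm_le_on_closedSlab`);
* `noFastEnergyConcentration_of_energyMorreyBound` — the piece BY NAME from the Morrey bound demanded along every flow
  (the registered open stub `stub_energy_morrey_bound` verbatim as hypothesis).

So X₁ holds along every first blow-up that is Type I IN SPACE energy-wise (in particular, by Leslie–Shvydkoy 2018
Prop. 3.2 / Thm. 1.2 — not in the tree — along every Type-I-in-time blow-up).
-/

noncomputable section

-- the summit and its single problem share the name `NavierStokesRegularity` (D-0017 nested layout)
set_option linter.dupNamespace false

namespace Summit.NavierStokesRegularity.NavierStokesRegularity.Theorems.NoFastEnergyConcentration.MorreyNullset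

open Set MeasureTheory Metric Literature.Analysis.FluidPDE
open Summit.NavierStokesRegularity.NavierStokesRegularity.Theorems.FastClassSqueeze
open scoped ENNReal NNReal

/-- **One flow: the energy Morrey bound gives uniform integrability of the energy over speed classes.**  Along a
classical solution of unforced Navier–Stokes on `ℝ³ × [0,T)` that is Leray–Hopf from a rapidly decaying datum: if
`∫_{B_r(x₀)} |u(t)|² ≤ C r` for every centre `x₀`, radius `r ∈ (0,r₀)` and time `t ∈ [0,T)` with `T − r² < t`, then
for every `ε > 0` there is a level `l > 0` with `∫_{|u(t)|>l} |u(t,x)|² dx ≤ ε` for all `t ∈ [0,T)`.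
[cite: CKN1982, Thm. B] [cite: Tao2011, Cor. 11.1] -/
theorem conclusion_of_energyMorreyBound {ν T : ℝ} (hν : 0 < ν) (hT : 0 < T)
    {u : ℝ → EuclideanSpace ℝ (Fin 3) → EuclideanSpace ℝ (Fin 3)} {p : ℝ → EuclideanSpace ℝ (Fin 3) → ℝ}
    (hcl : IsClassicalNSSolutionOn (Ico 0 T) ν 0 u p) (hLH : IsLerayHopfOn T ν 0 (u 0) u)
    (hdec : HasRapidSpatialDecay (u 0))
    (hMorrey : ∃ C r₀ : ℝ, 0 < r₀ ∧ ∀ x₀ : EuclideanSpace ℝ (Fin 3), ∀ r ∈ Ioo 0 r₀, ∀ t ∈ Ico 0 T,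
      T - r ^ 2 < t → ∫⁻ x in ball x₀ r, ‖u t x‖ₑ ^ 2 ≤ ENNReal.ofReal (C * r))
    {ε : ℝ} (hε : 0 < ε) :
    ∃ l : ℝ, 0 < l ∧ ∀ t ∈ Ico 0 T,
      ∫⁻ x in {x : EuclideanSpace ℝ (Fin 3) | l < ‖u t x‖}, ‖u t x‖ₑ ^ 2 ≤ ENNReal.ofReal ε := by
  obtain ⟨U, hU, hSU, τ, hτT, hsmall⟩ := stub_tightness_of_morrey ν T hν hT u p hcl hLH hdec hMorrey ε hε
  -- every high fast class lies inside `U`, for all `t < T`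
  obtain ⟨l₀, hl₀⟩ := Germ.exists_fastClass_subset hν hT hcl hLH hdec hU hSU
  -- `u` is bounded on the closed early slab `[0, τ']`, `τ' = max τ (T/2) ∈ (0,T)`
  have hτ'pos : 0 < max τ (T / 2) := lt_of_lt_of_le (by linarith) (le_max_right _ _)
  have hτ'T : max τ (T / 2) < T := max_lt hτT (by linarith)
  obtain ⟨M, hM⟩ := Birth.exists_forall_norm_le_on_closedSlab hν hcl hLH hdec hτ'pos hτ'T
  refine ⟨max (max l₀ M) 0 + 1, by positivity, fun t ht => ?_⟩
  by_cases htτ : t ≤ max τ (T / 2)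
  · -- early times: the fast class of level `max (max l₀ M) 0 + 1 > M` is empty
    have hempty : {x : EuclideanSpace ℝ (Fin 3) | max (max l₀ M) 0 + 1 < ‖u t x‖} = ∅ := by
      ext x
      simp only [Set.mem_setOf_eq, Set.mem_empty_iff_false, iff_false, not_lt]
      have hx := hM t ⟨ht.1, htτ⟩ x
      linarith [le_max_right l₀ M, le_max_left (max l₀ M) 0]
    rw [hempty, setLIntegral_empty]
    exact bot_le
  · -- late times: the fast class lies inside `U`, where the energy is `≤ ε`
    push Not at htτ
    have htτ0 : τ < t := lt_of_le_of_lt (le_max_left _ _) htτ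
    have hsub : {x : EuclideanSpace ℝ (Fin 3) | max (max l₀ M) 0 + 1 < ‖u t x‖} ⊆ U :=
      hl₀ _ (by linarith [le_max_left l₀ M, le_max_left (max l₀ M) 0]) t ht
    exact (lintegral_mono_set hsub).trans (hsmall t ht htτ0)

/-- **Piece X₁ from its open stub: the energy Morrey bound along every flow gives `NoFastEnergyConcentration`.**
The hypothesis is the registered stub `stub_energy_morrey_bound` of line `morrey-nullset` verbatim (Type I in space,
energy-wise); the conclusion is the route item by name.  [cite: CKN1982, Thm. B] [cite: Tao2011, Cor. 11.1] -/
theorem noFastEnergyConcentration_of_energyMorreyBound : (∀ (ν T : ℝ), 0 < ν → 0 < T → ∀ (u : ℝ → EuclideanSpace ℝ (Fin 3) → EuclideanSpace ℝ (Fin 3)) (p : ℝ → EuclideanSpace ℝ (Fin 3) → ℝ), Literature.Analysis.FluidPDE.IsClassicalNSSolutionOn (Set.Ico 0 T) ν 0 u p → Literature.Analysis.FluidPDE.IsLerayHopfOn T ν 0 (u 0) u → Literature.Analysis.FluidPDE.HasRapidSpatialDecay (u 0) → ∃ C r₀ : ℝ, 0 < r₀ ∧ ∀ x₀ : EuclideanSpace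 ℝ (Fin 3), ∀ r ∈ Set.Ioo 0 r₀, ∀ t ∈ Set.Ico 0 T, T - r ^ 2 < t → ∫⁻ x in Metric.ball x₀ r, ‖u t x‖ₑ ^ 2 ≤ ENNReal.ofReal (C * r)) → Summit.NavierStokesRegularity.NavierStokesRegularity.Theses.HodographBetchov.NoFastEnergyConcentration := by
  intro hMorrey ν T hν hT u p hcl hLH hdec ε hε
  exact conclusion_of_energyMorreyBound hν hT hcl hLH hdec (hMorrey ν T hν hT u p hcl hLH hdec) hε

end Summit.NavierStokesRegularity.NavierStokesRegularity.Theorems.NoFastEnergyConcentration.MorreyNullset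

end
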